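import Literature.AlgebraicGeometry.AbelianSchemes.RigidifiedLineBundleLimitDescentStage
import Literature.AlgebraicGeometry.AbelianSchemes.AbelianSchemeDualTransport
import Literature.AlgebraicGeometry.AbelianSchemes.RigidifyAlongUnitSlice
import Literature.AlgebraicGeometry.AbelianSchemes.PolarizedAbelianSchemeWithLevelBaseChangeUnique
import Literature.AlgebraicGeometry.AbelianSchemes.AbelianSchemeOverLevelBaseChange
import Literature.AlgebraicGeometry.ModuliOfAbelianVarieties.SiegelAdmissibleOfIsoId
import Literature.AlgebraicGeometry.Morphisms.GeometricPointsLiftSurjective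
import HarnessLib

/-!
# A line bundle on `B ×_Q B̂` pulling back to the Poincaré sheaf of `A ×_S Â` is fibrewise in `Pic⁰`
# — clause (a) of the dual pair descended along a free finite quotient of the base ([Mumford AV] §8, §13; [MFK94] Ch. 7 §3)

Topic `AlgebraicGeometry/AbelianSchemes`; namespace `Literature.AlgebraicGeometry.AbelianSchemes.AbelianSchemeOver`.
THEOREMS ONLY (no definition, no named fact, no instance, no notation, no `sorry`; net Literature debt 0).
Cell hodgecm-mathlib (D-0151), F-DAG price sheet leaf F-10 (10a), the DUAL-PAIR instalment, part 2 (sequel of ★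
`PoincareBaseQuotientDescent`, which produces a rigidified line bundle `𝒫_B` on `B ×_Q B̂` with `(π ×_p π̂)^*𝒫_B ≅ 𝒫`):
**every rigidified line bundle `P′` on `B ×_Q B̂` with `(π ×_p π̂)^* P′ ≅ 𝒫` is fibrewise in `Pic⁰` over `B̂`** —
clause (a) `fibrewisePicZero` of ★ `DualPair` for `(B̂, P′)`.  HC_CM is proved only modulo the 7 printed citations
until rung 0 closes; this file discharges none of them (count-neutral capital).

SETTING.  `p : S → Q` SURJECTIVE and locally of finite type (e.g. a finite étale quotient map); `A` an abelian scheme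
over `S` with a dual pair `D = (Â, 𝒫)`; `B`, `B̂` abelian schemes over `Q`; `π : A → B`, `π̂ : Â → B̂` exhibiting `A`,
`Â` as the base changes of `B`, `B̂` along `p` as group schemes (★ `IsBaseChangeVia`).  No group action is needed
here.  Write `ϖ := π ×_p π̂ : A ×_S Â → B ×_Q B̂` (`pullback.map`).

* §1 `isHomogeneous_fibreSlice_of_fibreModule` — (any abelian schemes `A`, `B` over one base) from the BUNDLE form
  of the fibre condition (★ `RigidifiedLineBundle.fibreModule` on `A_{B} = A ×_S B → B`) to the `DualPair`-FIELD form
  (slice `A_s × {b} ⊂ A ×_S B`, ★ `fibreSlice`): the converse bookkeeping of ★ `selfBundle_fibrewisePicZero`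
  (★ `fibreBaseChangeIso`).
* §2 `exists_iso_baseChange_prodMap` — **`A ×_S T′ ≅ B ×_Q T′` over `T′` as group schemes**, compatibly with
  `π ×_p c` and `1_B × c`, for any `c : T′ → T`, `f : T → Q`, `f′ : T′ → S` with `f′ ≫ p = c ≫ f` (here `T′ = Â`,
  `c = π̂`; in the sequels `T′ = T ×_Q S`): both are base changes of `B` along `c ≫ f` (★ `IsBaseChangeVia.trans`,
  ★ `baseChange_isBaseChangeVia`, ★ `exists_isBaseChangeVia_id`, ★ `exists_iso_of_isBaseChangeVia_id`).
* §3 **`isHomogeneous_fibreSlice_of_pullback_prodQuotientMap_iso`** — THE HEAD.  Proof: a geometric point `β` of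
  `B̂` LIFTS to `b′ : Spec Ω → Â` (★ `Morphisms.exists_comp_eq_of_surjective`: `π̂` is a base change of `p`); the
  slice of `P′` at `β = b′ ≫ π̂` is the fibre at `b′` of `(1_B × π̂)^* P′` on `B ×_Q Â → Â` (★
  `isHomogeneous_fibre_comapAlong_iff`), which along the isomorphism of §2 (★ `fibreIsoOfIso`,
  ★ `isHomogeneous_pullback_iff_of_iso`) is the fibre at `b′` of `ϖ^* P′ ≅ 𝒫` on `A ×_S Â → Â` — translation
  invariant by clause (a) of `D` (★ `selfBundle_fibrewisePicZero`).

Mathlib searched (pin): `MorphismProperty.IsStableUnderBaseChange.of_isPullback` (`Surjective`, `LocallyOfFiniteType`),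
`Scheme.Modules.pullbackComp` / `pullbackCongr` (used); no dual abelian schemes in Mathlib.

## References
* D. Mumford, *Abelian Varieties* (1970), §8 ((iv) ⇔ (i)) (pp. 74–81), §13 (p. 125). [MumfordAV1970]
* J. S. Milne, *Abelian Varieties* (v2.00, 2008), I §8 pp. 36–37. [MilneAV2008]
* D. Mumford, J. Fogarty, F. Kirwan, *Geometric Invariant Theory*, 3rd ed. (1994), Ch. 6 §2 (p. 121); Ch. 7 §3,
  remark after Thm. 7.9 and Lemma 7.11 (pp. 139–140). [MumfordFogartyKirwan1994]
* U. Görtz, T. Wedhorn, *Algebraic Geometry I*, 2nd ed. (2020), Section (4.7) (p. 135), Prop. 4.16 (p. 101). [GortzWedhorn2020]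
-/

noncomputable section

universe u

open CategoryTheory Limits AlgebraicGeometry MonoidalCategory CartesianMonoidalCategory MonObj

namespace Literature.AlgebraicGeometry.AbelianSchemes.AbelianSchemeOver

open Literature.AlgebraicGeometry.Modules Literature.AlgebraicGeometry.Motives
  Literature.AlgebraicGeometry.AbelianVarieties Literature.AlgebraicGeometry.Morphisms

set_option backward.isDefEq.respectTransparency false

/-! ### §1 From the bundle form of the fibre condition to the `DualPair`-field form -/

/-- **From the bundle form to the slice form of «`L|_{A × {b}} ∈ Pic⁰(A_b)`»**: for a rigidified line bundle `ℒ` on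
`A_{B} = A ×_S B → B` and a geometric point `b` of `B`, if the fibre `ℒ_b` on `(A_B)_b` is translation invariant then so
is the slice `ℒ|_{A_s × {b}}` on `A_s`, `s = b ≫ π_B` (transport along `(A_B)_b ≅ A_{b ≫ π_B}`, ★ `fibreBaseChangeIso`;
the converse bookkeeping of ★ `selfBundle_fibrewisePicZero`). [cite: MumfordAV1970, §8 ((iv) ⇔ (i))]
[cite: MilneAV2008, I §8 pp. 36–37] -/
theorem isHomogeneous_fibreSlice_of_fibreModule {S : Scheme.{u}} (A B : AbelianSchemeOver S)

    (ℒ : A.RigidifiedLineBundle B.X.hom) {Ω : Type u} [Field Ω] [IsAlgClosed Ω] (b : Spec (.of Ω) ⟶ B.X.left)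
    (h : IsHomogeneous ((A.baseChange B.X.hom).fibre b).toAbelianVariety (ℒ.fibreModule b)) :
    IsHomogeneous (A.fibre (b ≫ B.X.hom)).toAbelianVariety ((Scheme.Modules.pullback (A.fibreSlice B b)).obj ℒ.L) := by
  have hcond : pullback.fst (A.baseChange B.X.hom).X.hom b ≫ pullback.snd A.X.hom B.X.hom =
      pullback.snd (A.baseChange B.X.hom).X.hom b ≫ b := pullback.condition
  have hc : AbelianVariety.Hom.toSchemeHom (A.fibreBaseChangeIso B.X.hom b).hom ≫ A.fibreSlice B b =
      pullback.fst (A.baseChange B.X.hom).X.hom b := by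
    apply pullback.hom_ext
    · rw [Category.assoc, A.fibreSlice_fst B b, A.fibreBaseChangeIso_hom_toSchemeHom_fst B.X.hom b]
      rfl
    · rw [Category.assoc, A.fibreSlice_snd B b, ← Category.assoc, A.fibreBaseChangeIso_hom_toSchemeHom_snd B.X.hom b,
        hcond]
      rfl
  refine (isHomogeneous_pullback_iff_of_iso (A.fibreBaseChangeIso B.X.hom b) _).1 ?_
  exact (isHomogeneous_iff_of_iso _ ((Scheme.Modules.pullbackComp _ _).app ℒ.L ≪≫
    (Scheme.Modules.pullbackCongr hc).app ℒ.L)).2 h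

variable {S Q : Scheme.{u}} {p : S ⟶ Q}
  (A : AbelianSchemeOver S) (D : A.DualPair)
  (B : AbelianSchemeOver Q) {π : A.X.left ⟶ B.X.left} (hAB : A.IsBaseChangeVia B p π)
  (Bh : AbelianSchemeOver Q) {πh : D.hat.X.left ⟶ Bh.X.left} (hABh : D.hat.IsBaseChangeVia Bh p πh)

/-! ### §2 `A ×_S T′ ≅ B ×_Q T′` over `T′`, compatibly with `π ×_p c` and `1_B × c` -/

/-- **`A_{T′} = A ×_S T′ ≅ B_{T′} = B ×_Q T′` as group schemes over `T′`**, for any `f : T → Q`, `c : T′ → T`,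
`f′ : T′ → S` with `f′ ≫ p = c ≫ f`, by an isomorphism `e` with `e ≫ (1_B × c) = π ×_p c` (`pullback.map`): both sides
are base changes of `B` along `c ≫ f` — the left through `A ×_S T′ → A → B` over `T′ → S → Q` (★
`baseChange_isBaseChangeVia`, ★ `IsBaseChangeVia.trans` with `hAB`), the right the chosen one — hence related along
`𝟙_{T′}` by an isomorphism of group schemes (★ `exists_isBaseChangeVia_id`, ★ `exists_iso_of_isBaseChangeVia_id`).
(Used here with `T′ = Â`, `c = π̂`; by the sequels with `T′ = T ×_Q S`.) [cite: GortzWedhorn2020, Prop. 4.16 (p. 101)]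
[cite: MumfordFogartyKirwan1994, Ch. 7 §2 Definition 7.2 (p. 129)] -/
theorem exists_iso_baseChange_prodMap {T T' : Scheme.{u}} (f : T ⟶ Q) (c : T' ⟶ T) (f' : T' ⟶ S)
    (hc : f' ≫ p = c ≫ f) :
    ∃ e : (A.baseChange f').X ≅ (B.baseChange (c ≫ f)).X, IsMonHom e.hom ∧
      e.hom.left ≫ B.prodMap (c ≫ f) f c rfl = pullback.map A.X.hom f' B.X.hom f π c p hAB.fst.symm hc := by
  have h₁ : (A.baseChange f').IsBaseChangeVia B (c ≫ f) (pullback.fst A.X.hom f' ≫ π) := by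
    have h := (A.baseChange_isBaseChangeVia f').trans hAB
    rw [hc] at h
    exact h
  have h₂ := B.baseChange_isBaseChangeVia (c ≫ f)
  obtain ⟨H, _, hH, hid⟩ := IsBaseChangeVia.exists_isBaseChangeVia_id h₂ h₁
  obtain ⟨e, he, hmon⟩ := exists_iso_of_isBaseChangeVia_id hid
  refine ⟨e, hmon, ?_⟩
  have hsnd : e.hom.left ≫ pullback.snd B.X.hom (c ≫ f) = pullback.snd A.X.hom f' := Over.w e.hom
  apply pullback.hom_ext
  · rw [Category.assoc, prodMap_fst, pullback.lift_fst, he, hH]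
  · rw [Category.assoc, prodMap_snd, pullback.lift_snd, ← Category.assoc, hsnd]

/-! ### §3 Clause (a) of the descended dual pair -/

/-- **A LINE BUNDLE ON `B ×_Q B̂` PULLING BACK TO THE POINCARÉ SHEAF IS FIBREWISE IN `Pic⁰`.**  In the SETTING of the
module docstring, let `P′` be a line bundle on `B ×_Q B̂`, rigidified along `ε_B × 1_{B̂}`, with
`(π ×_p π̂)^* P′ ≅ 𝒫`.  Then for every geometric point `β` of `B̂` over `t`, the slice `P′|_{B_t × {β}}` is translation
invariant on `B_t` — clause (a) `fibrewisePicZero` of ★ `DualPair` for `(B̂, P′)`.  (Lift `β` to a geometric point `b′`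
of `Â` — `π̂` is surjective and locally of finite type as a base change of `p`; the slice at `β = b′ ≫ π̂` is, along
`A ×_S Â ≅ B ×_Q Â` over `Â` (§2) and `B_t ≅ A_{s}`, the slice of `𝒫` at `b′`, which lies in `Pic⁰` by clause (a) of
`D`.)  With ★ `PoincareBaseQuotientDescent` this leaves only the universal property for «the dual pair descends
along `M → M/Γ`». [cite: MumfordAV1970, §8 ((iv) ⇔ (i)) and §13 (p. 125)] [cite: MilneAV2008, I §8 pp. 36–37]
[cite: MumfordFogartyKirwan1994, Ch. 7 §3, remark after Thm. 7.9 and Lemma 7.11 (pp. 139–140)] -/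
theorem isHomogeneous_fibreSlice_of_pullback_prodQuotientMap_iso [Surjective p] [LocallyOfFiniteType p]
    (P' : (B.prodLeft Bh).Modules) (h1 : HasRank P' 1)
    (hrig : Nonempty ((Scheme.Modules.pullback (B.unitSlice Bh)).obj P' ≅ SheafOfModules.unit _))
    (e : Nonempty ((Scheme.Modules.pullback
      (pullback.map A.X.hom D.hat.X.hom B.X.hom Bh.X.hom π πh p hAB.fst.symm hABh.fst.symm)).obj P' ≅ D.P))
    (Ω : Type u) [Field Ω] [IsAlgClosed Ω] (β : Spec (.of Ω) ⟶ Bh.X.left) :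
    IsHomogeneous (B.fibre (β ≫ Bh.X.hom)).toAbelianVariety ((Scheme.Modules.pullback (B.fibreSlice Bh β)).obj P') := by
  -- `π̂` is a base change of `p`: surjective and locally of finite type, so geometric points of `B̂` lift to `Â`
  haveI : Surjective πh := MorphismProperty.IsStableUnderBaseChange.of_isPullback hABh.snd.1.flip inferInstance
  haveI : LocallyOfFiniteType πh :=
    MorphismProperty.IsStableUnderBaseChange.of_isPullback hABh.snd.1.flip inferInstance
  obtain ⟨b', rfl⟩ := exists_comp_eq_of_surjective πh β
  -- `P'` as a rigidified line bundle on `B_{B̂} = B ×_Q B̂`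
  let ℒ₂ : B.RigidifiedLineBundle Bh.X.hom :=
    { L := P'
      hasRank_one := h1
      rigid := ⟨(Scheme.Modules.pullbackCongr (B.unitSection_baseChange_eq_unitSlice Bh)).app P' ≪≫ hrig.some⟩ }
  refine isHomogeneous_fibreSlice_of_fibreModule B Bh ℒ₂ (b' ≫ πh) ?_
  refine (ℒ₂.isHomogeneous_fibre_comapAlong_iff πh rfl Ω b').1 ?_
  -- transport from `A ×_S Â → Â` along the isomorphism of §2
  obtain ⟨E, hEm, hE⟩ := exists_iso_baseChange_prodMap A B hAB Bh.X.hom πh D.hat.X.hom hABh.fst.symm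
  obtain ⟨e⟩ := e
  haveI := hEm
  have key := DualPair.selfBundle_fibrewisePicZero D Ω b'
  refine (isHomogeneous_pullback_iff_of_iso (fibreIsoOfIso E b') ((ℒ₂.comapAlong πh rfl).fibreModule b')).1 ?_
  refine (isHomogeneous_iff_of_iso _ ?_).1 key
  -- the modules: `fst₁^* 𝒫 ≅ fst₁^* E^* (1 × π̂)^* P' ≅ φ^* fst₂^* (1 × π̂)^* P'`
  exact (Scheme.Modules.pullback (pullback.fst (A.baseChange D.hat.X.hom).X.hom b')).mapIso
      (e.symm ≪≫ (Scheme.Modules.pullbackCongr hE.symm).app P' ≪≫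
        ((Scheme.Modules.pullbackComp E.hom.left (B.prodMap (πh ≫ Bh.X.hom) Bh.X.hom πh rfl)).app P').symm) ≪≫
    (Scheme.Modules.pullbackComp (pullback.fst (A.baseChange D.hat.X.hom).X.hom b') E.hom.left).app _ ≪≫
    (Scheme.Modules.pullbackCongr (fibreIsoOfIso_hom_toSchemeHom_fst E b').symm).app _ ≪≫
    ((Scheme.Modules.pullbackComp (AbelianVariety.Hom.toSchemeHom (fibreIsoOfIso E b').hom)
      (pullback.fst (B.baseChange (πh ≫ Bh.X.hom)).X.hom b')).app _).symm

end Literature.AlgebraicGeometry.AbelianSchemes.AbelianSchemeOver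

end
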